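import Summits.CriticalPhenomena.PercolationContinuityZ3.Theorems.SahiMasterFamilyLightAtoms

/-!
# Strictness of Sahi's hierarchy at every order, III: the first- and second-order terms of the light-atom expansion

Support file of the master-family programme (crux `NoHeavyLowerTail`, stmt-CriticalPhenomena-4575; cell `prim-masterthm`,
seat P4, unit `prim-masterthm-p4-g4`).  Generic in the finite type `α` and the real weight `μ`; continues
`SahiMasterFamilyLightAtoms` (`S₁ − S₂ − T ≤ E_{n+1}(U) ≤ S₁ − S₂ + T`).

* `sumOne_eq`: `S₁ = Σ_{a ∈ ⋂_i U_i} ffm (μ a) n` — systems of representatives with one value are the constants;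
* `sumTwo_eq`: `S₂ = Σ_{(a,b), a ≠ b} Σ_{B ∈ radm (rows U a) (rows U b)} ffm (μ a) (|B|−1) · ffm (μ b) (n−|B|)` — a system with
  exactly two values, rooted at slot `0` (`a = γ 0`), is an ordered pair of distinct atoms with a rooted admissible split
  (`twoVal a b B`; `rows U a = {i : a ∈ U_i}`; `SahiPairFunctional.radm`);
* hence, for a light family (masses `≤ δ ≤ 1`), `sumTwo_le`: `S₂ ≤ Σ_{(a,b)} μa·μb·rpairSum (rows U a) (rows U b)` and
  `le_sumTwo`: `(1 − nδ)·Σ_{(a,b)} μa·μb·rpairSum (rows U a) (rows U b) ≤ S₂` when `nδ ≤ 1`.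
HONEST FRAMING: elementary counting and estimates; [this work].  Used by `SahiMasterFamilyStrictHierarchy`.
-/

namespace Summit.CriticalPhenomena.PercolationContinuityZ3.Theorems

namespace SahiLightAtoms

open Finset Function Polynomial
open Literature.Combinatorics.Sahi2008 SahiRepresentativeForm SahiPairFunctional

variable {α : Type*} [Fintype α] [DecidableEq α]

/-! ### `S₁`: constant systems of representatives -/

omit [Fintype α] in
/-- A map with a one-point image is constant. [folklore] -/
theorem eq_const_of_card_image_eq_one {n : ℕ} {γ : Fin (n + 1) → α} (h : (univ.image γ).card = 1) :
    γ = fun _ => γ 0 := by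
  obtain ⟨a, ha⟩ := card_eq_one.1 h
  have hall : ∀ i, γ i = a := fun i => by
    have : γ i ∈ univ.image γ := mem_image_of_mem γ (mem_univ i)
    rw [ha, mem_singleton] at this
    exact this
  funext i
  rw [hall i, hall 0]

omit [Fintype α] in
/-- `M` of a constant system on `n+1` slots is `ffm (μ a) n`. [this work] -/
theorem absWeight_const (μ : α → ℝ) (n : ℕ) (a : α) : absWeight μ (fun _ : Fin (n + 1) => a) = ffm (μ a) n := by
  unfold absWeight
  rw [image_const univ_nonempty, prod_singleton]
  congr 1
  rw [occ, filter_true_of_mem fun _ _ => rfl, card_univ, Fintype.card_fin, Nat.add_sub_cancel]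

/-- **`S₁ = Σ_{a ∈ ⋂ U_i} ffm (μ a) n`.** [this work] -/
theorem sumOne_eq (μ : α → ℝ) {n : ℕ} (U : Fin (n + 1) → Finset α) :
    sumOne μ U = ∑ a ∈ univ.filter (fun a => ∀ i, a ∈ U i), ffm (μ a) n := by
  unfold sumOne
  refine sum_nbij' (fun γ => γ 0) (fun a _ => a) ?_ ?_ ?_ ?_ ?_
  · intro γ hγ
    rw [mem_filter] at hγ
    rw [mem_filter]
    refine ⟨mem_univ _, fun i => ?_⟩
    have h := congrFun (eq_const_of_card_image_eq_one hγ.2) i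
    rw [← h]
    exact Fintype.mem_piFinset.1 hγ.1 i
  · intro a ha
    rw [mem_filter] at ha
    rw [mem_filter, Fintype.mem_piFinset, image_const univ_nonempty, card_singleton]
    exact ⟨fun i => ha.2 i, rfl⟩
  · intro γ hγ
    rw [mem_filter] at hγ
    exact (eq_const_of_card_image_eq_one hγ.2).symm
  · intro a _
    rfl
  · intro γ hγ
    rw [mem_filter] at hγ
    conv_lhs => rw [eq_const_of_card_image_eq_one hγ.2]
    exact absWeight_const μ n (γ 0)

/-! ### `S₂`: two-valued systems of representatives, rooted at slot `0` -/

/-- The two-valued system of the rooted split `B`: slots in `B` represented by `a`, the others by `b`. [this work] -/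
def twoVal {n : ℕ} (a b : α) (B : Finset (Fin n)) : Fin n → α := fun i => if i ∈ B then a else b

omit [Fintype α] in
/-- The slots represented by `a` are exactly `B` (for `a ≠ b`). [this work] -/
theorem filter_twoVal_eq_left {n : ℕ} {a b : α} (hab : a ≠ b) (B : Finset (Fin n)) :
    univ.filter (fun i => twoVal a b B i = a) = B := by
  ext i
  simp only [mem_filter, mem_univ, true_and, twoVal]
  split_ifs with h
  · simp [h]
  · simp [h, hab.symm]

omit [Fintype α] in
/-- The slots represented by `b` are exactly `Bᶜ` (for `a ≠ b`). [this work] -/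
theorem filter_twoVal_eq_right {n : ℕ} {a b : α} (hab : a ≠ b) (B : Finset (Fin n)) :
    univ.filter (fun i => twoVal a b B i = b) = univ \ B := by
  ext i
  simp only [mem_filter, mem_univ, true_and, twoVal, mem_sdiff]
  split_ifs with h
  · simp [h, hab]
  · simp [h]

omit [Fintype α] in
/-- The image of a two-valued system of a rooted proper split is `{a, b}`. [this work] -/
theorem image_twoVal {n : ℕ} (a b : α) {B : Finset (Fin (n + 1))} (h0 : (0 : Fin (n + 1)) ∈ B) (hB : B ≠ univ) :
    univ.image (twoVal a b B) = {a, b} := by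
  obtain ⟨j, -, hj⟩ := exists_of_ssubset (ssubset_univ_iff.2 hB)
  ext x
  simp only [mem_image, mem_univ, true_and, mem_insert, mem_singleton, twoVal]
  constructor
  · rintro ⟨i, rfl⟩
    split_ifs <;> simp
  · rintro (rfl | rfl)
    · exact ⟨0, by simp [h0]⟩
    · exact ⟨j, by simp [hj]⟩

omit [Fintype α] in
/-- `M` of the two-valued system of a rooted admissible split. [this work] -/
theorem absWeight_twoVal (μ : α → ℝ) {n : ℕ} {a b : α} (hab : a ≠ b) {B : Finset (Fin (n + 1))}
    (h0 : (0 : Fin (n + 1)) ∈ B) (hB : B ≠ univ) :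
    absWeight μ (twoVal a b B) = ffm (μ a) (#B - 1) * ffm (μ b) (n - #B) := by
  unfold absWeight
  rw [image_twoVal a b h0 hB, prod_pair hab]
  have ha : occ (twoVal a b B) a = #B := by rw [occ, filter_twoVal_eq_left hab]
  have hb : occ (twoVal a b B) b = n + 1 - #B := by
    rw [occ, filter_twoVal_eq_right hab, card_univ_sdiff, Fintype.card_fin]
  rw [ha, hb]
  congr 2
  omega

/-- **`S₂` as a sum over ordered pairs of distinct atoms and rooted admissible splits.** [this work] -/
theorem sumTwo_eq (μ : α → ℝ) {n : ℕ} (U : Fin (n + 1) → Finset α) :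
    sumTwo μ U = ∑ p ∈ (univ : Finset α).offDiag, ∑ B ∈ radm (rows U p.1) (rows U p.2),
      ffm (μ p.1) (#B - 1) * ffm (μ p.2) (n - #B) := by
  unfold sumTwo
  rw [sum_sigma']
  symm
  refine sum_nbij (fun x => twoVal x.1.1 x.1.2 x.2) ?_ ?_ ?_ ?_
  · -- maps into two-valued systems of representatives
    rintro ⟨⟨a, b⟩, B⟩ hx
    rw [mem_sigma, mem_offDiag, mem_radm] at hx
    obtain ⟨⟨-, -, hab⟩, h0, hB, hRa, hRb⟩ := hx
    rw [mem_filter, Fintype.mem_piFinset, image_twoVal a b h0 hB, card_pair hab]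
    refine ⟨fun i => ?_, rfl⟩
    simp only [twoVal]
    split_ifs with hi
    · exact mem_rows.1 (hRa hi)
    · exact mem_rows.1 (hRb (mem_sdiff.2 ⟨mem_univ _, hi⟩))
  · -- injective
    rintro ⟨⟨a, b⟩, B⟩ hx ⟨⟨a', b'⟩, B'⟩ hx' heq
    simp only [Finset.mem_coe, mem_sigma, mem_offDiag, mem_radm] at hx hx'
    obtain ⟨⟨-, -, hab⟩, h0, hB, -, -⟩ := hx
    obtain ⟨⟨-, -, hab'⟩, h0', hB', -, -⟩ := hx'
    have e0 := congrFun heq 0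
    simp only [twoVal, if_pos h0, if_pos h0'] at e0
    subst e0
    have hBB : B = B' := by
      ext i
      have ei := congrFun heq i
      simp only [twoVal] at ei
      constructor
      · intro hi
        rw [if_pos hi] at ei
        by_contra hi'
        rw [if_neg hi'] at ei
        exact hab' ei
      · intro hi'
        rw [if_pos hi'] at ei
        by_contra hi
        rw [if_neg hi] at ei
        exact hab ei.symm
    subst hBB
    obtain ⟨j, -, hj⟩ := exists_of_ssubset (ssubset_univ_iff.2 hB)
    have ej := congrFun heq j
    simp only [twoVal, if_neg hj] at ej
    subst ej
    rfl
  · -- surjective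
    intro γ hγ
    rw [Finset.mem_coe, mem_filter, Fintype.mem_piFinset] at hγ
    obtain ⟨hγS, hcard⟩ := hγ
    obtain ⟨x, y, hxy, hxy'⟩ := card_eq_two.1 hcard
    set a := γ 0 with ha
    set b := if γ 0 = x then y else x with hb
    set B : Finset (Fin (n + 1)) := univ.filter (fun i => γ i = γ 0) with hBdef
    have hmem : ∀ i, γ i = x ∨ γ i = y := fun i => by
      have : γ i ∈ univ.image γ := mem_image_of_mem γ (mem_univ i)
      rw [hxy', mem_insert, mem_singleton] at this
      exact this
    have hab : a ≠ b := by
      rw [hb]; split_ifs with h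
      · rw [ha, h]; exact hxy
      · exact h
    have hother : ∀ i, γ i ≠ γ 0 → γ i = b := by
      intro i hi
      rw [hb]
      rcases hmem i with hi' | hi' <;> rcases hmem 0 with h0 | h0
      · exact absurd (hi'.trans h0.symm) hi
      · rw [if_neg (by rw [h0]; exact hxy.symm)]; exact hi'
      · rw [if_pos h0]; exact hi'
      · exact absurd (hi'.trans h0.symm) hi
    have hγeq : twoVal a b B = γ := by
      funext i
      simp only [twoVal, hBdef, mem_filter, mem_univ, true_and]
      split_ifs with h
      · rw [ha, h]
      · exact (hother i h).symm
    obtain ⟨j, hj⟩ : ∃ j, γ j ≠ γ 0 := by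
      by_contra hcon
      push Not at hcon
      have : univ.image γ = {γ 0} := by
        rw [show γ = fun _ => γ 0 from funext hcon]; exact image_const univ_nonempty _
      rw [this, card_singleton] at hcard
      exact absurd hcard (by norm_num)
    refine ⟨⟨⟨a, b⟩, B⟩, ?_, hγeq⟩
    rw [Finset.mem_coe, mem_sigma, mem_offDiag, mem_radm]
    refine ⟨⟨mem_univ _, mem_univ _, hab⟩, by simp [hBdef], ?_, ?_, ?_⟩
    · intro h
      have hjB : j ∈ B := by
        have h' : B = univ := h
        rw [h']
        exact mem_univ j
      rw [hBdef, mem_filter] at hjB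
      exact hj hjB.2
    · intro i hi
      rw [hBdef, mem_filter] at hi
      rw [mem_rows, ha, ← hi.2]
      exact hγS i
    · intro i hi
      rw [mem_sdiff, hBdef, mem_filter] at hi
      have hi' : γ i ≠ γ 0 := fun h => hi.2 ⟨mem_univ _, h⟩
      rw [mem_rows, ← hother i hi']
      exact hγS i
  · -- values agree
    rintro ⟨⟨a, b⟩, B⟩ hx
    rw [mem_sigma, mem_offDiag, mem_radm] at hx
    obtain ⟨⟨-, -, hab⟩, h0, hB, -, -⟩ := hx
    exact (absWeight_twoVal μ hab h0 hB).symm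

omit [Fintype α] in
/-- The atoms of a rooted admissible split are atoms of the family (hence light). [this work] -/
theorem light_of_mem_radm {μ : α → ℝ} {n : ℕ} {U : Fin (n + 1) → Finset α} {δ : ℝ}
    (hU : ∀ i, ∀ a ∈ U i, 0 ≤ μ a ∧ μ a ≤ δ) {a b : α} {B : Finset (Fin (n + 1))}
    (hB : B ∈ radm (rows U a) (rows U b)) : (0 ≤ μ a ∧ μ a ≤ δ) ∧ (0 ≤ μ b ∧ μ b ≤ δ) := by
  rw [mem_radm] at hB
  obtain ⟨h0, hBu, hRa, hRb⟩ := hB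
  obtain ⟨j, -, hj⟩ := exists_of_ssubset (ssubset_univ_iff.2 hBu)
  exact ⟨hU 0 a (mem_rows.1 (hRa h0)), hU j b (mem_rows.1 (hRb (mem_sdiff.2 ⟨mem_univ _, hj⟩)))⟩

/-- **Upper bound on `S₂`** by the rooted pair functional: `S₂ ≤ Σ_{(a,b)} μa·μb·rpairSum (rows a) (rows b)`. [this work] -/
theorem sumTwo_le (μ : α → ℝ) {n : ℕ} (U : Fin (n + 1) → Finset α) {δ : ℝ} (hδ1 : δ ≤ 1)
    (hU : ∀ i, ∀ a ∈ U i, 0 ≤ μ a ∧ μ a ≤ δ) :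
    sumTwo μ U ≤ ∑ p ∈ (univ : Finset α).offDiag, μ p.1 * μ p.2 * (rpairSum (rows U p.1) (rows U p.2) : ℝ) := by
  rw [sumTwo_eq]
  refine sum_le_sum fun p _ => ?_
  rw [rpairSum, Nat.cast_sum, mul_sum]
  refine sum_le_sum fun B hB => ?_
  obtain ⟨⟨ha0, haδ⟩, hb0, hbδ⟩ := light_of_mem_radm hU hB
  rw [pw, Nat.cast_mul]
  calc ffm (μ p.1) (#B - 1) * ffm (μ p.2) (n - #B)
      ≤ (μ p.1 * (#B - 1).factorial) * (μ p.2 * (n - #B).factorial) :=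
        mul_le_mul (ffm_le ha0 (haδ.trans hδ1) _) (ffm_le hb0 (hbδ.trans hδ1) _)
          (ffm_nonneg hb0 (hbδ.trans hδ1) _) (mul_nonneg ha0 (Nat.cast_nonneg _))
    _ = μ p.1 * μ p.2 * ((#B - 1).factorial * (n - #B).factorial) := by ring

/-- **Lower bound on `S₂`**: `(1 − nδ)·Σ_{(a,b)} μa·μb·rpairSum (rows a) (rows b) ≤ S₂` if `nδ ≤ 1`. [this work] -/
theorem le_sumTwo (μ : α → ℝ) {n : ℕ} (U : Fin (n + 1) → Finset α) {δ : ℝ} (hδ1 : δ ≤ 1) (hnδ : n * δ ≤ 1)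
    (hU : ∀ i, ∀ a ∈ U i, 0 ≤ μ a ∧ μ a ≤ δ) :
    (1 - n * δ) * ∑ p ∈ (univ : Finset α).offDiag, μ p.1 * μ p.2 * (rpairSum (rows U p.1) (rows U p.2) : ℝ) ≤
      sumTwo μ U := by
  rw [sumTwo_eq, mul_sum]
  refine sum_le_sum fun p _ => ?_
  rw [rpairSum, Nat.cast_sum, mul_sum, mul_sum]
  refine sum_le_sum fun B hB => ?_
  obtain ⟨⟨ha0, haδ⟩, hb0, hbδ⟩ := light_of_mem_radm hU hB
  have hBle : #B ≤ n + 1 := by simpa using card_le_univ B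
  rw [pw, Nat.cast_mul]
  set m := #B - 1 with hm
  set m' := n - #B with hm'
  have hmm' : (m : ℝ) + m' ≤ n := by
    have : m + m' ≤ n := by omega
    exact_mod_cast this
  have hmx : (m : ℝ) * μ p.1 ≤ m * δ := mul_le_mul_of_nonneg_left haδ (Nat.cast_nonneg _)
  have hmy : (m' : ℝ) * μ p.2 ≤ m' * δ := mul_le_mul_of_nonneg_left hbδ (Nat.cast_nonneg _)
  have hδ0 : 0 ≤ δ := ha0.trans haδ
  have hm0 : (0 : ℝ) ≤ m := Nat.cast_nonneg _
  have hm'0 : (0 : ℝ) ≤ m' := Nat.cast_nonneg _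
  have hLa : 0 ≤ 1 - m * δ := by nlinarith
  have hLb : 0 ≤ 1 - m' * δ := by nlinarith
  have h1 : μ p.1 * (m.factorial * (1 - m * δ)) ≤ ffm (μ p.1) m :=
    (mul_le_mul_of_nonneg_left (mul_le_mul_of_nonneg_left (by linarith) (Nat.cast_nonneg _)) ha0).trans
      (ffm_ge ha0 (haδ.trans hδ1) m)
  have h2 : μ p.2 * (m'.factorial * (1 - m' * δ)) ≤ ffm (μ p.2) m' :=
    (mul_le_mul_of_nonneg_left (mul_le_mul_of_nonneg_left (by linarith) (Nat.cast_nonneg _)) hb0).trans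
      (ffm_ge hb0 (hbδ.trans hδ1) m')
  have hprod : (1 - n * δ) ≤ (1 - m * δ) * (1 - m' * δ) := by
    have hexp : (1 - (m : ℝ) * δ) * (1 - m' * δ) = 1 - (m + m') * δ + m * m' * (δ * δ) := by ring
    have hA : (0 : ℝ) ≤ m * m' * (δ * δ) := by positivity
    have hB : ((m : ℝ) + m') * δ ≤ n * δ := mul_le_mul_of_nonneg_right hmm' hδ0
    rw [hexp]
    linarith
  have hfa : (0 : ℝ) ≤ m.factorial := Nat.cast_nonneg _
  have hfb : (0 : ℝ) ≤ m'.factorial := Nat.cast_nonneg _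
  calc (1 - n * δ) * (μ p.1 * μ p.2 * ((m.factorial : ℝ) * m'.factorial))
      ≤ ((1 - m * δ) * (1 - m' * δ)) * (μ p.1 * μ p.2 * ((m.factorial : ℝ) * m'.factorial)) :=
        mul_le_mul_of_nonneg_right hprod (by positivity)
    _ = (μ p.1 * (m.factorial * (1 - m * δ))) * (μ p.2 * (m'.factorial * (1 - m' * δ))) := by ring
    _ ≤ ffm (μ p.1) m * ffm (μ p.2) m' :=
        mul_le_mul h1 h2 (by positivity) (ffm_nonneg ha0 (haδ.trans hδ1) _)

end SahiLightAtoms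

end Summit.CriticalPhenomena.PercolationContinuityZ3.Theorems
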